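import Summits.ResolutionOfSingularities.ResolutionOfSingularities.Theorems.HilbertSamuelEliminationCampaignW42NearChain
import Literature.AlgebraicGeometry.CossartJannsenSaito2020.KeyTheoremsIsolated
import HarnessLib

/-!
# [OURS · L1 W4.2] K2-sep ROUTE A, brick (β3): **the Hilbert–Samuel locus, isolation and maximal origins TRANSFER along a morphism that
# preserves `H` pointwise** (the shape of the projection `X ×_k K → X` of a separable ground-field extension once (β1)+(β2) give
# `H_{X_K}(x′) = H_X(x)` at every point)
# (crux `SigmaMaxModifications` stmt-ResolutionOfSingularities-18506 / conjunct stmt-…-19249; line `w_ladder_rows` v8.5, registered stub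
# `stub_isoSepRecurrent`; res-L1-w42-plan-1 WORD 2026-08-27T16:25:47Z; design `L/res-L1-w42-stub-2/k2sep/K2SEP-DESIGN.md` §6 (β3))

Prover res-L1-w42-stub-2 (gen 5). Helper file `--supports stmt-ResolutionOfSingularities-19249 --as helper`; point-set statements over the
tree's `Scheme.hsFun` / `Scheme.hsMaxLocus` / `IsIsolatedInHSMaxLocus` / `IsMaximalOrigin`; no definitions, no named fact. OURS (cell res-hironaka,
slot W4.2); NOT statements of [Hironaka2017] nor of [CossartJannsenSaito2020]. AI-written; AI review is weaker than expert review.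

For `f : X′ → X` of locally noetherian schemes with `H^N_{X′}(y) = H^N_X(f y)` for all `y` (hypothesis `hH`) and `f` surjective:
* `hsValues_eq_of_hsFun_eq` — `Σ_{X′} = Σ_X`; `hsMaxLocus_eq_preimage_of_hsFun_eq` — `X′_max = f⁻¹ X_max`;
  `hsStratum_eq_preimage_of_hsFun_eq`.
* **`isIsolatedInHSMaxLocus_of_hsFun_eq`** — if `x` is ISOLATED in `X_max`, the fibre `f⁻¹{x}` is finite and consists of closed points, then
  every `x′` over `x` is isolated in `X′_max` (the neighbourhood `f⁻¹U` minus the other fibre points).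
* **`isMaximalOrigin_of_hsFun_eq`** — a maximal origin `(X, x)` at level `N`, value `ν`, characteristic `p` transfers to `(X′, x′)` for `x′`
  closed over `x`, given that `X′` is reduced, separated of finite type over a field of characteristic `p` and `dim X′ ≤ N` (the inputs a
  ground-field base change supplies: reducedness by (α), finite type over `K`, `dim X_K = dim X`).

[OURS · L1 W4.2; AI-written] [cite: CossartJannsenSaito2020, Def. 2.28, Def. 2.35, Def. 13.3]
-/

set_option linter.dupNamespace false

noncomputable section

open CategoryTheory AlgebraicGeometry TopologicalSpace
open Literature.AlgebraicGeometry.Resolution Literature.AlgebraicGeometry.CossartJannsenSaito2020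
open Summit.ResolutionOfSingularities.ResolutionOfSingularities.Theorems.CampaignW42

namespace Summit.ResolutionOfSingularities.ResolutionOfSingularities.Theorems.SigmaMaxModificationsCorridor3.IsoTailsHS

universe u

variable {X' X : Scheme.{u}} (f : X' ⟶ X) (N : ℕ)

/-- `Σ_{X′} = Σ_X` when `f` is surjective and preserves `H` pointwise. [cite: CossartJannsenSaito2020, Def. 2.35] -/
theorem hsValues_eq_of_hsFun_eq (hH : ∀ y : X', Scheme.hsFun X' N y = Scheme.hsFun X N (f.base y))
    (hsurj : Function.Surjective f.base) : Scheme.hsValues X' N = Scheme.hsValues X N := by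
  ext ν
  simp only [Scheme.hsValues, Set.mem_range]
  constructor
  · rintro ⟨y, rfl⟩; exact ⟨f.base y, (hH y).symm⟩
  · rintro ⟨x, rfl⟩
    obtain ⟨y, rfl⟩ := hsurj x
    exact ⟨y, hH y⟩

/-- **`X′_max = f⁻¹ X_max`** when `f` is surjective and preserves `H` pointwise. [cite: CossartJannsenSaito2020, Def. 2.35] -/
theorem hsMaxLocus_eq_preimage_of_hsFun_eq (hH : ∀ y : X', Scheme.hsFun X' N y = Scheme.hsFun X N (f.base y))
    (hsurj : Function.Surjective f.base) : Scheme.hsMaxLocus X' N = f.base ⁻¹' Scheme.hsMaxLocus X N := by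
  ext y
  simp only [Scheme.hsMaxLocus, Set.mem_setOf_eq, Set.mem_preimage]
  rw [hsValues_eq_of_hsFun_eq f N hH hsurj, hH y]

/-- `X′(ν) = f⁻¹ X(ν)` when `f` preserves `H` pointwise. [cite: CossartJannsenSaito2020, Def. 2.28 (4)] -/
theorem hsStratum_eq_preimage_of_hsFun_eq (hH : ∀ y : X', Scheme.hsFun X' N y = Scheme.hsFun X N (f.base y)) (ν : ℕ → ℕ) :
    Scheme.hsStratum X' N ν = f.base ⁻¹' Scheme.hsStratum X N ν := by
  ext y
  simp only [Scheme.hsStratum, Set.mem_setOf_eq, Set.mem_preimage]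
  rw [hH y]

/-- **ISOLATION TRANSFERS along an `H`-preserving surjection with finite closed fibre**: if `x` is isolated in `X_max`, `f⁻¹{x}` is finite and
consists of closed points, then every `x′ ∈ f⁻¹{x}` is isolated in `X′_max` (take `f⁻¹U ∖ (f⁻¹{x} ∖ {x′})`). The shape of
`X ×_k K → X` for `K/k` algebraic (fibre over `x` = `Spec(κ(x) ⊗_k K)`, finite discrete). [cite: CossartJannsenSaito2020, Def. 13.3] -/
theorem isIsolatedInHSMaxLocus_of_hsFun_eq [IsLocallyNoetherian X'] [IsLocallyNoetherian X] (hH : ∀ y : X', Scheme.hsFun X' N y = Scheme.hsFun X N (f.base y))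
    (hsurj : Function.Surjective f.base) {x : X} (hiso : IsIsolatedInHSMaxLocus X N x)
    (hfin : (f.base ⁻¹' {x}).Finite) (hcl : ∀ y ∈ f.base ⁻¹' {x}, IsClosed ({y} : Set X')) {x' : X'} (hx' : f.base x' = x) :
    IsIsolatedInHSMaxLocus X' N x' := by
  obtain ⟨U, hU, hUmax⟩ := hiso
  -- the other fibre points form a closed set
  have hF : IsClosed (f.base ⁻¹' {x} \ {x'}) := by
    have : f.base ⁻¹' {x} \ {x'} = ⋃ y ∈ (hfin.sdiff (t := {x'})).toFinset, {y} := by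
      ext z; simp
    rw [this]
    exact isClosed_biUnion_finset fun y hy => hcl y ((Set.Finite.mem_toFinset _).mp hy).1
  refine ⟨f.base ⁻¹' U ∩ (f.base ⁻¹' {x} \ {x'})ᶜ, (hU.preimage f.base.hom.continuous).inter hF.isOpen_compl, ?_⟩
  rw [hsMaxLocus_eq_preimage_of_hsFun_eq f N hH hsurj]
  ext z
  simp only [Set.mem_inter_iff, Set.mem_preimage, Set.mem_compl_iff, Set.mem_sdiff, Set.mem_singleton_iff, not_and, not_not]
  constructor
  · rintro ⟨⟨hzU, hzF⟩, hzmax⟩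
    have hz : f.base z ∈ U ∩ Scheme.hsMaxLocus X N := ⟨hzU, hzmax⟩
    rw [hUmax, Set.mem_singleton_iff] at hz
    exact hzF hz
  · rintro rfl
    have hx : x ∈ U ∩ Scheme.hsMaxLocus X N := by rw [hUmax]; exact Set.mem_singleton x
    exact ⟨⟨hx' ▸ hx.1, fun _ => rfl⟩, hx' ▸ hx.2⟩

/-- **MAXIMAL ORIGINS TRANSFER along an `H`-preserving surjection**: `(X, x)` a maximal origin at level `N`, value `ν`, characteristic `p`;
`X′` reduced, separated and of finite type over a field of characteristic `p` with `dim X′ ≤ N`; `x′` a CLOSED point over `x` ⟹ `(X′, x′)` is a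
maximal origin at level `N`, value `ν` (maximality of `ν` from `Σ_{X′} = Σ_X`, membership from `H_{X′}(x′) = H_X(x) = ν`).
[OURS · L1 W4.2] [cite: CossartJannsenSaito2020, Def. 2.35] -/
theorem isMaximalOrigin_of_hsFun_eq {p : ℕ} {ν : ℕ → ℕ} (hH : ∀ y : X', Scheme.hsFun X' N y = Scheme.hsFun X N (f.base y))
    (hsurj : Function.Surjective f.base) {x : X} (hO : IsMaximalOrigin p N ν X x)
    (hstr : ∃ (K : Type u) (_ : Field K) (_ : CharP K p) (g : X' ⟶ Spec (.of K)), IsSeparated g ∧ LocallyOfFiniteType g ∧ QuasiCompact g)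
    (hred : IsReduced X') (hdim : topologicalKrullDim X' ≤ (N : WithBot ℕ∞)) {x' : X'} (hx' : f.base x' = x)
    (hcl : IsClosed ({x'} : Set X')) : IsMaximalOrigin p N ν X' x' where
  exists_structure := hstr
  isReduced := hred
  dim_le := hdim
  maximal := by rw [hsValues_eq_of_hsFun_eq f N hH hsurj]; exact hO.maximal
  isClosed := hcl
  mem_stratum := by
    rw [hsStratum_eq_preimage_of_hsFun_eq f N hH, Set.mem_preimage, hx']
    exact hO.mem_stratum

end Summit.ResolutionOfSingularities.ResolutionOfSingularities.Theorems.SigmaMaxModificationsCorridor3.IsoTailsHS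

end
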